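import Summits.ABC.ABC.Theses.RibetTakahashiSplit
import Summits.ABC.ABC.Theorems.RibetTakahashiSplitManyPrimeValuationProductCoveringGlue
import Literature.NumberTheory.Automorphic.ShimuraCurve

/-!
# Line `switching-triangle` for crux `FewPrimeValuationProduct` (stmt-ABC-1563): the glue

Support file (`--supports stmt-ABC-1563`) for the crux
`Summit.ABC.ABC.Theses.RibetTakahashiSplit.FewPrimeValuationProduct` (route `RibetTakahashiSplit`,
r4: `T(E) := ∏_{p ∥ N} c_p ≤ C_ε N^ε`, `c_p := ord_p Δ_min`, for `E/ℚ` semistable away from `2`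
with `≤ 3` odd multiplicative primes): the sorry-free glue of the line's registered skeleton
`Cruxes/FewPrimeValuationProduct/Lines/switching_triangle.lean`, re-homed under
`Summit.ABC.ABC.Theorems.FewPrimeValuationProduct` as the two registered theorems
* `pairwiseGcdBound_of_parts` — two-prime package (`stub_twoPrimePackage`) + two-prime mean-square
  lower bound (`stub_twoPrimeMeanSquareLowerBound`, the lever) ⟹ the PAIRWISE GCD BOUND
  `c_p c_q ≤ C_ε N^ε gcd(c_p,c_q)²` for distinct multiplicative primes `p ≠ q`;
* `fewPrimeValuationProduct_of_pairwise_depth` — pairwise gcd bound + the depth statements of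
  `stub_depthSemistable`, `stub_depthFrey`, `stub_depthResidual` (H_card form) on
  `G := gcd_{p ∈ Mult} c_p` ⟹ the crux BY NAME, through the SIMPLEX LEMMA `switching_simplex_bound`
  (`#S ≤ 4`, `c_a ≥ 1`, `c_a c_b ≤ X gcd(c_a,c_b)²` for `a ≠ b` ⟹ `∏ c_a ≤ X^{12} (gcd_a c_a)^4`).
Helpers carry the prefix `switching_`; tree inputs `WeierstrassCurve.conductorNorm_pos_holds` and
`ManyPrimeValuationProduct.one_le_factorization_of_mem_filter` (`c_p ≥ 1` on `Mult(W)`, from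
`WeierstrassCurve.radical_conductorNorm_eq_holds`; sibling crux r2's covering glue). Not here: the
five stubs (hypotheses only); any `def` (the skeleton's `PairwiseGcdBound` is written out).
-/

-- `Summit.<Summit>.<Problem>`: for the single-conjunct summit `ABC` the duplicate `ABC.ABC` is mandated.
set_option linter.dupNamespace false

namespace Summit.ABC.ABC.Theorems.FewPrimeValuationProduct

/-- `m ≤ e^{A} · g²` from `log m ≤ A + 2 log g` (degenerate cases `g = 0 ⟹ m = 0`, `m = 0` included).
[folklore] -/
theorem switching_natMul_le_of_log_le {m g : ℕ} {A : ℝ}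
    (h : Real.log (m : ℝ) ≤ A + 2 * Real.log (g : ℝ)) (hmg : g = 0 → m = 0) :
    (m : ℝ) ≤ Real.exp A * ((g ^ 2 : ℕ) : ℝ) := by
  rcases Nat.eq_zero_or_pos g with hg | hg
  · simp [hmg hg, hg]
  rcases Nat.eq_zero_or_pos m with hm | hm
  · simp only [hm, Nat.cast_zero]
    positivity
  have hm' : (0 : ℝ) < m := by exact_mod_cast hm
  have hg' : (0 : ℝ) < g := by exact_mod_cast hg
  calc (m : ℝ) = Real.exp (Real.log m) := (Real.exp_log hm').symm
    _ ≤ Real.exp (A + 2 * Real.log g) := Real.exp_le_exp.mpr h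
    _ = Real.exp A * ((g ^ 2 : ℕ) : ℝ) := by
        rw [Real.exp_add, show (2 : ℝ) * Real.log g = Real.log g + Real.log g by ring,
          Real.exp_add, Real.exp_log hg']
        push_cast; ring

/-- **Package + lever ⟹ the pairwise gcd bound** (registered glue of line `switching-triangle`; the
hypotheses are the statements of `stub_twoPrimePackage` and `stub_twoPrimeMeanSquareLowerBound`).
With `V = vol F`, `I = ∫_F ‖s‖²_pt`, `g = gcd(c_p,c_q)`: `log(c_p c_q) ≤ C₁ + (ε/2) log N + 2 log g +
log V − log I` and `−((ε/2) log N + C₂) ≤ log(V⁻¹ I)` give `c_p c_q ≤ e^{C₁+C₂} N^ε g²`. [folklore] -/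
theorem pairwiseGcdBound_of_parts :
    (∀ ε : ℝ, 0 < ε → ∃ C : ℝ, ∀ (W : WeierstrassCurve ℚ) [W.IsElliptic],
      (∀ p : ℕ, p.Prime → p ≠ 2 → ¬ p ^ 2 ∣ W.conductorNorm ℤ) →
      ∀ p ∈ (W.conductorNorm ℤ).primeFactors.filter (fun p => ¬ p ^ 2 ∣ W.conductorNorm ℤ),
      ∀ q ∈ (W.conductorNorm ℤ).primeFactors.filter (fun p => ¬ p ^ 2 ∣ W.conductorNorm ℤ), p ≠ q →
        ∃ (L : PeriodPair) (X : Literature.NumberTheory.Automorphic.ShimuraCurveData (p * q)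
          (W.conductorNorm ℤ / (p * q))) (F : Set UpperHalfPlane) (s : CuspForm X.Gamma 2),
          (∃ C' : WeierstrassCurve.VariableChange ℚ, (C' • W).IsGloballyMinimal ∧
            Literature.NumberTheory.EllipticCurves.ModularForms.IsNeronLatticeOf
              ((C' • W).baseChange ℂ) L) ∧
          Literature.NumberTheory.Automorphic.IsHypFundamentalDomain X.Gamma F ∧
          MeasureTheory.volume F ≠ 0 ∧ MeasureTheory.volume F ≠ ⊤ ∧ s ≠ 0 ∧
          Literature.NumberTheory.Automorphic.HasPeriodsIn X.Gamma s (L.lattice : Set ℂ) ∧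
          MeasureTheory.IntegrableOn (fun z => ‖s z‖ ^ 2 * z.im ^ 2) F ∧
          (0 < ∫ z in F, ‖s z‖ ^ 2 * z.im ^ 2) ∧
          Real.log (((W.minimalDiscriminantNorm ℤ).factorization p *
              (W.minimalDiscriminantNorm ℤ).factorization q : ℕ) : ℝ) ≤
            C + ε * Real.log (W.conductorNorm ℤ) +
              2 * Real.log (Nat.gcd ((W.minimalDiscriminantNorm ℤ).factorization p)
                ((W.minimalDiscriminantNorm ℤ).factorization q)) +
              Real.log (MeasureTheory.volume F).toReal - Real.log (∫ z in F, ‖s z‖ ^ 2 * z.im ^ 2)) →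
    (∀ ε : ℝ, 0 < ε → ∃ C : ℝ, ∀ (W : WeierstrassCurve ℚ) [W.IsElliptic],
      (∀ p : ℕ, p.Prime → p ≠ 2 → ¬ p ^ 2 ∣ W.conductorNorm ℤ) →
      ∀ p ∈ (W.conductorNorm ℤ).primeFactors.filter (fun p => ¬ p ^ 2 ∣ W.conductorNorm ℤ),
      ∀ q ∈ (W.conductorNorm ℤ).primeFactors.filter (fun p => ¬ p ^ 2 ∣ W.conductorNorm ℤ), p ≠ q →
      ∀ (L : PeriodPair), (∃ C' : WeierstrassCurve.VariableChange ℚ, (C' • W).IsGloballyMinimal ∧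
        Literature.NumberTheory.EllipticCurves.ModularForms.IsNeronLatticeOf ((C' • W).baseChange ℂ) L) →
      ∀ (X : Literature.NumberTheory.Automorphic.ShimuraCurveData (p * q) (W.conductorNorm ℤ / (p * q)))
        (F : Set UpperHalfPlane), Literature.NumberTheory.Automorphic.IsHypFundamentalDomain X.Gamma F →
        MeasureTheory.volume F ≠ 0 → MeasureTheory.volume F ≠ ⊤ → ∀ (s : CuspForm X.Gamma 2), s ≠ 0 →
        Literature.NumberTheory.Automorphic.HasPeriodsIn X.Gamma s (L.lattice : Set ℂ) →
        MeasureTheory.IntegrableOn (fun z => ‖s z‖ ^ 2 * z.im ^ 2) F →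
        (0 < ∫ z in F, ‖s z‖ ^ 2 * z.im ^ 2) → -(ε * Real.log (W.conductorNorm ℤ) + C) ≤
          Real.log ((MeasureTheory.volume F).toReal⁻¹ * ∫ z in F, ‖s z‖ ^ 2 * z.im ^ 2)) →
    ∀ ε : ℝ, 0 < ε → ∃ C : ℝ, ∀ (W : WeierstrassCurve ℚ) [W.IsElliptic],
      (∀ p : ℕ, p.Prime → p ≠ 2 → ¬ p ^ 2 ∣ W.conductorNorm ℤ) →
      ∀ p ∈ (W.conductorNorm ℤ).primeFactors.filter (fun p => ¬ p ^ 2 ∣ W.conductorNorm ℤ),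
      ∀ q ∈ (W.conductorNorm ℤ).primeFactors.filter (fun p => ¬ p ^ 2 ∣ W.conductorNorm ℤ), p ≠ q →
        (((W.minimalDiscriminantNorm ℤ).factorization p *
            (W.minimalDiscriminantNorm ℤ).factorization q : ℕ) : ℝ) ≤ C * (W.conductorNorm ℤ : ℝ) ^ ε *
          ((Nat.gcd ((W.minimalDiscriminantNorm ℤ).factorization p)
            ((W.minimalDiscriminantNorm ℤ).factorization q) ^ 2 : ℕ) : ℝ) := by
  intro hPk hL ε hε
  have hε2 : 0 < ε / 2 := half_pos hε
  obtain ⟨C₁, hC₁⟩ := hPk (ε / 2) hε2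
  obtain ⟨C₂, hC₂⟩ := hL (ε / 2) hε2
  refine ⟨Real.exp (C₁ + C₂), fun W _ hss p hp q hq hpq => ?_⟩
  obtain ⟨L, X, F, s, hLn, hFD, hF0, hFt, hs0, hper, hint, hIpos, hineq⟩ := hC₁ W hss p hp q hq hpq
  have hlev := hC₂ W hss p hp q hq hpq L hLn X F hFD hF0 hFt s hs0 hper hint hIpos
  set N : ℝ := (W.conductorNorm ℤ : ℝ) with hNdef
  set V : ℝ := (MeasureTheory.volume F).toReal with hVdef
  set I : ℝ := ∫ z in F, ‖s z‖ ^ 2 * z.im ^ 2 with hIdef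
  set cp : ℕ := (W.minimalDiscriminantNorm ℤ).factorization p with hcp
  set cq : ℕ := (W.minimalDiscriminantNorm ℤ).factorization q with hcq
  have hN : 0 < N := by rw [hNdef]; exact_mod_cast W.conductorNorm_pos_holds
  have hV : 0 < V := ENNReal.toReal_pos hF0 hFt
  have hlogVI : Real.log (V⁻¹ * I) = Real.log I - Real.log V := by
    rw [Real.log_mul (inv_ne_zero hV.ne') hIpos.ne', Real.log_inv]; ring
  rw [hlogVI] at hlev
  have hlog : Real.log ((cp * cq : ℕ) : ℝ) ≤
      (C₁ + C₂ + ε * Real.log N) + 2 * Real.log (Nat.gcd cp cq : ℝ) := by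
    have : ε / 2 * Real.log N + ε / 2 * Real.log N = ε * Real.log N := by ring
    linarith
  have hdeg : Nat.gcd cp cq = 0 → cp * cq = 0 := fun h0 => by
    rw [(Nat.gcd_eq_zero_iff.mp h0).1, zero_mul]
  calc ((cp * cq : ℕ) : ℝ)
      ≤ Real.exp (C₁ + C₂ + ε * Real.log N) * ((Nat.gcd cp cq ^ 2 : ℕ) : ℝ) :=
        switching_natMul_le_of_log_le hlog hdeg
    _ = Real.exp (C₁ + C₂) * N ^ ε * ((Nat.gcd cp cq ^ 2 : ℕ) : ℝ) := by
        rw [Real.exp_add, Real.rpow_def_of_pos hN, mul_comm (Real.log N) ε]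

/-- Two divisors `d, e` of `n > 0` satisfy `d · e ≤ n · gcd(d, e)` (as `lcm(d,e) ∣ n`). [folklore] -/
theorem switching_mul_le_mul_gcd_of_dvd {n d e : ℕ} (hn : 0 < n) (hd : d ∣ n) (he : e ∣ n) :
    d * e ≤ n * Nat.gcd d e := by
  calc d * e = Nat.gcd d e * Nat.lcm d e := (Nat.gcd_mul_lcm d e).symm
    _ ≤ Nat.gcd d e * n := Nat.mul_le_mul_left _ (Nat.le_of_dvd hn (Nat.lcm_dvd hd he))
    _ = n * Nat.gcd d e := Nat.mul_comm _ _

/-- **Divisors lemma**: if `d_b ∣ n` for all `b ∈ s` (`n > 0`) then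
`n · ∏_{b ∈ s} d_b ≤ n^{#s} · gcd(n, gcd_b d_b)`. [folklore] -/
theorem switching_mul_prod_le_pow_mul_gcd {n : ℕ} (hn : 0 < n) (s : Finset ℕ) (d : ℕ → ℕ)
    (hd : ∀ b ∈ s, d b ∣ n) :
    n * ∏ b ∈ s, d b ≤ n ^ s.card * Nat.gcd n (s.gcd d) := by
  classical
  induction s using Finset.induction_on with
  | empty => simp
  | @insert b s hb ih =>
    have ih' := ih fun x hx => hd x (Finset.mem_insert_of_mem hx)
    have hdb : d b ∣ n := hd b (Finset.mem_insert_self b s)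
    have he : Nat.gcd n (s.gcd d) ∣ n := Nat.gcd_dvd_left _ _
    rw [Finset.prod_insert hb, Finset.card_insert_of_notMem hb, Finset.gcd_insert]
    have hgcd : Nat.gcd n (GCDMonoid.gcd (d b) (s.gcd d)) = Nat.gcd (d b) (Nat.gcd n (s.gcd d)) := by
      show Nat.gcd n (Nat.gcd (d b) (s.gcd d)) = Nat.gcd (d b) (Nat.gcd n (s.gcd d))
      rw [← Nat.gcd_assoc, Nat.gcd_comm n (d b), Nat.gcd_assoc]
    rw [hgcd]
    calc n * (d b * ∏ x ∈ s, d x) = d b * (n * ∏ x ∈ s, d x) := by ring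
      _ ≤ d b * (n ^ s.card * Nat.gcd n (s.gcd d)) := Nat.mul_le_mul_left _ ih'
      _ = n ^ s.card * (d b * Nat.gcd n (s.gcd d)) := by ring
      _ ≤ n ^ s.card * (n * Nat.gcd (d b) (Nat.gcd n (s.gcd d))) :=
          Nat.mul_le_mul_left _ (switching_mul_le_mul_gcd_of_dvd hn hdb he)
      _ = n ^ (s.card + 1) * Nat.gcd (d b) (Nat.gcd n (s.gcd d)) := by ring

/-- `gcd(x, gcd_b gcd(x, f_b)) = gcd(x, gcd_b f_b)`. [folklore] -/
theorem switching_gcd_finsetGcd_gcd (x : ℕ) (s : Finset ℕ) (f : ℕ → ℕ) :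
    Nat.gcd x (s.gcd (fun b => Nat.gcd x (f b))) = Nat.gcd x (s.gcd f) := by
  apply Nat.dvd_antisymm
  · refine Nat.dvd_gcd (Nat.gcd_dvd_left _ _) (Finset.dvd_gcd fun b hb => ?_)
    exact ((Nat.gcd_dvd_right _ _).trans (Finset.gcd_dvd hb)).trans (Nat.gcd_dvd_right _ _)
  · refine Nat.dvd_gcd (Nat.gcd_dvd_left _ _) (Finset.dvd_gcd fun b hb => ?_)
    exact Nat.dvd_gcd (Nat.gcd_dvd_left _ _) ((Nat.gcd_dvd_right _ _).trans (Finset.gcd_dvd hb))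

/-- **The simplex bound (switching triangle).** If `#S ≤ 4`, all `c_a ≥ 1` (`a ∈ S`) and
`c_a c_b ≤ X · gcd(c_a,c_b)²` for all `a ≠ b` in `S` (`X ≥ 1`), then
`∏_{a ∈ S} c_a ≤ X^{12} · (gcd_{a ∈ S} c_a)^4`: with `a` minimising `c`, `c_b ≤ X gcd(c_a,c_b)`, the
divisors lemma gives `c_a ∏_b gcd(c_a,c_b) ≤ c_a^{#S-1} G`, and `c_a^{#S} ≤ ∏ c`. [folklore] -/
theorem switching_simplex_bound {S : Finset ℕ} {c : ℕ → ℕ} {X : ℕ} (hX : 1 ≤ X) (hS : S.Nonempty)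
    (hk : S.card ≤ 4) (hc : ∀ a ∈ S, 1 ≤ c a)
    (h : ∀ a ∈ S, ∀ b ∈ S, a ≠ b → c a * c b ≤ X * Nat.gcd (c a) (c b) ^ 2) :
    ∏ a ∈ S, c a ≤ X ^ 12 * S.gcd c ^ 4 := by
  classical
  obtain ⟨a, ha, hmin⟩ := S.exists_min_image c hS
  set G := S.gcd c with hGdef
  set s := S.erase a with hsdef
  set j := s.card with hjdef
  have hj : j + 1 = S.card := Finset.card_erase_add_one ha
  have hj3 : j ≤ 3 := by omega
  have hca0 : 0 < c a := hc a ha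
  have hG : 1 ≤ G := Nat.pos_of_ne_zero fun h0 => by
    have := (Finset.gcd_eq_zero_iff.mp h0) a ha; omega
  have hA : ∀ b ∈ s, c b ≤ X * Nat.gcd (c a) (c b) := by
    intro b hb
    obtain ⟨hba, hbS⟩ := Finset.mem_erase.mp hb
    set g := Nat.gcd (c a) (c b) with hgdef
    have hg0 : 0 < g := Nat.gcd_pos_of_pos_left _ hca0
    have h1 : g * c b ≤ g * (X * g) :=
      calc g * c b ≤ c a * c b := Nat.mul_le_mul_right _ (Nat.le_of_dvd hca0 (Nat.gcd_dvd_left _ _))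
        _ ≤ X * g ^ 2 := h a ha b hbS hba.symm
        _ = g * (X * g) := by ring
    exact Nat.le_of_mul_le_mul_left h1 hg0
  have hB1 : ∏ b ∈ s, c b ≤ X ^ j * ∏ b ∈ s, Nat.gcd (c a) (c b) := by
    calc ∏ b ∈ s, c b ≤ ∏ b ∈ s, (X * Nat.gcd (c a) (c b)) := Finset.prod_le_prod' hA
      _ = X ^ j * ∏ b ∈ s, Nat.gcd (c a) (c b) := by rw [Finset.prod_mul_distrib, Finset.prod_const]
  have hdiv : c a * ∏ b ∈ s, Nat.gcd (c a) (c b) ≤ c a ^ j * G := by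
    have h1 := switching_mul_prod_le_pow_mul_gcd hca0 s (fun b => Nat.gcd (c a) (c b))
      (fun b _ => Nat.gcd_dvd_left _ _)
    have h2 : Nat.gcd (c a) (s.gcd (fun b => Nat.gcd (c a) (c b))) = G := by
      rw [switching_gcd_finsetGcd_gcd, hGdef, ← Finset.insert_erase ha, Finset.gcd_insert]
      rfl
    rwa [h2] at h1
  have hT : ∏ b ∈ S, c b ≤ X ^ j * c a ^ j * G := by
    calc ∏ b ∈ S, c b = c a * ∏ b ∈ s, c b := (Finset.mul_prod_erase S c ha).symm
      _ ≤ c a * (X ^ j * ∏ b ∈ s, Nat.gcd (c a) (c b)) := Nat.mul_le_mul_left _ hB1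
      _ = X ^ j * (c a * ∏ b ∈ s, Nat.gcd (c a) (c b)) := by ring
      _ ≤ X ^ j * (c a ^ j * G) := Nat.mul_le_mul_left _ hdiv
      _ = X ^ j * c a ^ j * G := by ring
  have hminT : c a ^ (j + 1) ≤ ∏ b ∈ S, c b := by
    rw [hj]; exact Finset.pow_card_le_prod S c (c a) fun b hb => hmin b hb
  have hcaXG : c a ≤ X ^ j * G := by
    have h1 : c a ^ j * c a ≤ c a ^ j * (X ^ j * G) := by
      calc c a ^ j * c a = c a ^ (j + 1) := (pow_succ _ _).symm
        _ ≤ X ^ j * c a ^ j * G := hminT.trans hT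
        _ = c a ^ j * (X ^ j * G) := by ring
    exact Nat.le_of_mul_le_mul_left h1 (pow_pos hca0 j)
  have hXj : X ^ j ≤ X ^ 3 := Nat.pow_le_pow_right hX hj3
  have hXG : 1 ≤ X ^ 3 * G := Nat.one_le_iff_ne_zero.mpr (by positivity)
  have hcaj : c a ^ j ≤ (X ^ 3 * G) ^ 3 :=
    calc c a ^ j ≤ (X ^ j * G) ^ j := Nat.pow_le_pow_left hcaXG j
      _ ≤ (X ^ 3 * G) ^ j := Nat.pow_le_pow_left (Nat.mul_le_mul_right _ hXj) j
      _ ≤ (X ^ 3 * G) ^ 3 := Nat.pow_le_pow_right hXG hj3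
  calc ∏ b ∈ S, c b ≤ X ^ j * c a ^ j * G := hT
    _ ≤ X ^ 3 * (X ^ 3 * G) ^ 3 * G := Nat.mul_le_mul (Nat.mul_le_mul hXj hcaj) le_rfl
    _ = X ^ 12 * G ^ 4 := by ring

/-- At most four multiplicative primes in the few-prime class (`≤ 3` odd ones, perhaps `2`). [folklore] -/
theorem switching_card_filter_le_four (W : WeierstrassCurve ℚ)
    (hcard : ((W.conductorNorm ℤ).primeFactors.filter
      (fun p => p ≠ 2 ∧ ¬ p ^ 2 ∣ W.conductorNorm ℤ)).card ≤ 3) :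
    ((W.conductorNorm ℤ).primeFactors.filter (fun p => ¬ p ^ 2 ∣ W.conductorNorm ℤ)).card ≤ 4 := by
  classical
  have h : (W.conductorNorm ℤ).primeFactors.filter (fun p => p ≠ 2 ∧ ¬ p ^ 2 ∣ W.conductorNorm ℤ) =
      ((W.conductorNorm ℤ).primeFactors.filter (fun p => ¬ p ^ 2 ∣ W.conductorNorm ℤ)).erase 2 := by
    ext p; simp only [Finset.mem_filter, Finset.mem_erase]; tauto
  have := Finset.pred_card_le_card_erase
    (s := (W.conductorNorm ℤ).primeFactors.filter (fun p => ¬ p ^ 2 ∣ W.conductorNorm ℤ)) (a := 2)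
  rw [← h] at this; omega

/-- **The switching-triangle composition, relative to a sub-class `P`**: the pairwise gcd bound
plus a depth bound `G(E) ≤ C_ε N^ε` on the curves of the few-prime class satisfying `P` give
`T(E) ≤ C_ε N^ε` there. With `X := ⌈K₁ N^{ε/16}⌉` and `G ≤ K₂ N^{ε/16}` the simplex bound gives
`T ≤ X^{12} G^4 ≤ (K₁+1)^{12} K₂^4 N^ε`. [folklore] -/
theorem switching_valProd_le_of_bounds (P : WeierstrassCurve ℚ → Prop)
    (hP : ∀ ε : ℝ, 0 < ε → ∃ C : ℝ, ∀ (W : WeierstrassCurve ℚ) [W.IsElliptic],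
      (∀ p : ℕ, p.Prime → p ≠ 2 → ¬ p ^ 2 ∣ W.conductorNorm ℤ) →
      ∀ p ∈ (W.conductorNorm ℤ).primeFactors.filter (fun p => ¬ p ^ 2 ∣ W.conductorNorm ℤ),
      ∀ q ∈ (W.conductorNorm ℤ).primeFactors.filter (fun p => ¬ p ^ 2 ∣ W.conductorNorm ℤ), p ≠ q →
        (((W.minimalDiscriminantNorm ℤ).factorization p *
            (W.minimalDiscriminantNorm ℤ).factorization q : ℕ) : ℝ) ≤ C * (W.conductorNorm ℤ : ℝ) ^ ε *
          ((Nat.gcd ((W.minimalDiscriminantNorm ℤ).factorization p)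
            ((W.minimalDiscriminantNorm ℤ).factorization q) ^ 2 : ℕ) : ℝ))
    (hD : ∀ ε : ℝ, 0 < ε → ∃ C : ℝ, ∀ (W : WeierstrassCurve ℚ) [W.IsElliptic],
      (∀ p : ℕ, p.Prime → p ≠ 2 → ¬ p ^ 2 ∣ W.conductorNorm ℤ) →
      ((W.conductorNorm ℤ).primeFactors.filter (fun p => p ≠ 2 ∧ ¬ p ^ 2 ∣ W.conductorNorm ℤ)).card ≤ 3 →
      P W → ((W.conductorNorm ℤ).primeFactors.filter (fun p => ¬ p ^ 2 ∣ W.conductorNorm ℤ)).Nonempty →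
        ((((W.conductorNorm ℤ).primeFactors.filter (fun p => ¬ p ^ 2 ∣ W.conductorNorm ℤ)).gcd
          (fun p => (W.minimalDiscriminantNorm ℤ).factorization p) : ℕ) : ℝ) ≤
          C * (W.conductorNorm ℤ : ℝ) ^ ε) :
    ∀ ε : ℝ, 0 < ε → ∃ C : ℝ, ∀ (W : WeierstrassCurve ℚ) [W.IsElliptic],
      (∀ p : ℕ, p.Prime → p ≠ 2 → ¬ p ^ 2 ∣ W.conductorNorm ℤ) →
      ((W.conductorNorm ℤ).primeFactors.filter (fun p => p ≠ 2 ∧ ¬ p ^ 2 ∣ W.conductorNorm ℤ)).card ≤ 3 →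
      P W → ((∏ p ∈ (W.conductorNorm ℤ).primeFactors with ¬ p ^ 2 ∣ W.conductorNorm ℤ,
          (W.minimalDiscriminantNorm ℤ).factorization p : ℕ) : ℝ) ≤ C * (W.conductorNorm ℤ : ℝ) ^ ε := by
  classical
  intro ε hε
  have hε' : 0 < ε / 16 := by positivity
  obtain ⟨C₁, hC₁⟩ := hP (ε / 16) hε'
  obtain ⟨C₂, hC₂⟩ := hD (ε / 16) hε'
  set K₁ : ℝ := max C₁ 0 + 1 with hK₁
  set K₂ : ℝ := max C₂ 1 with hK₂
  have hK₁1 : 1 ≤ K₁ := by have := le_max_right C₁ 0; linarith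
  have hK₁C : C₁ ≤ K₁ := by have := le_max_left C₁ 0; linarith
  have hK₂1 : 1 ≤ K₂ := le_max_right _ _
  refine ⟨(K₁ + 1) ^ 12 * K₂ ^ 4, fun W _ hss hcard hPW => ?_⟩
  set N : ℝ := (W.conductorNorm ℤ : ℝ) with hNdef
  set S : Finset ℕ := (W.conductorNorm ℤ).primeFactors.filter (fun p => ¬ p ^ 2 ∣ W.conductorNorm ℤ)
    with hSdef
  set c : ℕ → ℕ := fun p => (W.minimalDiscriminantNorm ℤ).factorization p with hcdef
  have hN1 : 1 ≤ N := by rw [hNdef]; exact_mod_cast W.conductorNorm_pos_holds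
  have hN0 : 0 < N := by linarith
  have hNε' : 1 ≤ N ^ (ε / 16) := Real.one_le_rpow hN1 hε'.le
  have hNε : 1 ≤ N ^ ε := Real.one_le_rpow hN1 hε.le
  have hconst1 : 1 ≤ (K₁ + 1) ^ 12 * K₂ ^ 4 :=
    one_le_mul_of_one_le_of_one_le (one_le_pow₀ (by linarith)) (one_le_pow₀ hK₂1)
  have hTS : (∏ p ∈ (W.conductorNorm ℤ).primeFactors with ¬ p ^ 2 ∣ W.conductorNorm ℤ,
      (W.minimalDiscriminantNorm ℤ).factorization p) = ∏ p ∈ S, c p := rfl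
  rw [hTS]
  by_cases hS : S.Nonempty
  swap
  · rw [Finset.not_nonempty_iff_eq_empty.mp hS, Finset.prod_empty, Nat.cast_one]
    exact one_le_mul_of_one_le_of_one_le hconst1 hNε
  set X : ℕ := ⌈K₁ * N ^ (ε / 16)⌉₊ with hXdef
  have hKN : 1 ≤ K₁ * N ^ (ε / 16) := one_le_mul_of_one_le_of_one_le hK₁1 hNε'
  have hX1 : 1 ≤ X := Nat.one_le_iff_ne_zero.mpr fun h0 => by
    have := Nat.ceil_eq_zero.mp h0; linarith
  have hXle : (X : ℝ) ≤ (K₁ + 1) * N ^ (ε / 16) := by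
    have h1 : (X : ℝ) < K₁ * N ^ (ε / 16) + 1 := Nat.ceil_lt_add_one (by linarith)
    nlinarith
  have hpair : ∀ a ∈ S, ∀ b ∈ S, a ≠ b → c a * c b ≤ X * Nat.gcd (c a) (c b) ^ 2 := by
    intro a ha b hb hab
    have hg0 : (0 : ℝ) ≤ ((Nat.gcd (c a) (c b) ^ 2 : ℕ) : ℝ) := Nat.cast_nonneg _
    have h2 : C₁ * N ^ (ε / 16) ≤ (X : ℝ) :=
      (mul_le_mul_of_nonneg_right hK₁C (by positivity)).trans (Nat.le_ceil _)
    have h3 : ((c a * c b : ℕ) : ℝ) ≤ (X : ℝ) * ((Nat.gcd (c a) (c b) ^ 2 : ℕ) : ℝ) :=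
      (hC₁ W hss a ha b hb hab).trans (mul_le_mul_of_nonneg_right h2 hg0)
    exact_mod_cast h3
  have hsimp := switching_simplex_bound hX1 hS (switching_card_filter_le_four W hcard)
    (fun a ha => ManyPrimeValuationProduct.one_le_factorization_of_mem_filter W ha) hpair
  have hG : ((S.gcd c : ℕ) : ℝ) ≤ K₂ * N ^ (ε / 16) :=
    (hC₂ W hss hcard hPW hS).trans (mul_le_mul_of_nonneg_right (le_max_left _ _) (by positivity))
  have hpow : (N ^ (ε / 16)) ^ (16 : ℕ) = N ^ ε := by
    rw [← Real.rpow_natCast, ← Real.rpow_mul hN0.le]; norm_num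
  calc ((∏ p ∈ S, c p : ℕ) : ℝ) ≤ ((X ^ 12 * S.gcd c ^ 4 : ℕ) : ℝ) := by exact_mod_cast hsimp
    _ = (X : ℝ) ^ 12 * ((S.gcd c : ℕ) : ℝ) ^ 4 := by push_cast; ring
    _ ≤ ((K₁ + 1) * N ^ (ε / 16)) ^ 12 * (K₂ * N ^ (ε / 16)) ^ 4 := by gcongr
    _ = (K₁ + 1) ^ 12 * K₂ ^ 4 * (N ^ (ε / 16)) ^ (16 : ℕ) := by ring
    _ = (K₁ + 1) ^ 12 * K₂ ^ 4 * N ^ ε := by rw [hpow]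

/-- **Pairwise gcd bound + the three depth statements ⟹ the crux
`Summit.ABC.ABC.Theses.RibetTakahashiSplit.FewPrimeValuationProduct`, BY NAME** (registered glue of
line `switching-triangle`; hypotheses: the pairwise gcd bound and the statements of
`stub_depthSemistable`, `stub_depthFrey`, `stub_depthResidual` (H_card form)). Excluded middle on
`Squarefree N` and on the twisted-Frey shape gives `G(E) ≤ (5 + B + max C₃ 0) N^ε` on the whole
class; then `switching_valProd_le_of_bounds` with `P := True`. [folklore] -/
theorem fewPrimeValuationProduct_of_pairwise_depth :
    (∀ ε : ℝ, 0 < ε → ∃ C : ℝ, ∀ (W : WeierstrassCurve ℚ) [W.IsElliptic],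
      (∀ p : ℕ, p.Prime → p ≠ 2 → ¬ p ^ 2 ∣ W.conductorNorm ℤ) →
      ∀ p ∈ (W.conductorNorm ℤ).primeFactors.filter (fun p => ¬ p ^ 2 ∣ W.conductorNorm ℤ),
      ∀ q ∈ (W.conductorNorm ℤ).primeFactors.filter (fun p => ¬ p ^ 2 ∣ W.conductorNorm ℤ), p ≠ q →
        (((W.minimalDiscriminantNorm ℤ).factorization p *
            (W.minimalDiscriminantNorm ℤ).factorization q : ℕ) : ℝ) ≤ C * (W.conductorNorm ℤ : ℝ) ^ ε *
          ((Nat.gcd ((W.minimalDiscriminantNorm ℤ).factorization p)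
            ((W.minimalDiscriminantNorm ℤ).factorization q) ^ 2 : ℕ) : ℝ)) →
    (∀ (W : WeierstrassCurve ℚ) [W.IsElliptic], Squarefree (W.conductorNorm ℤ) →
      ((W.conductorNorm ℤ).primeFactors.filter (fun p => ¬ p ^ 2 ∣ W.conductorNorm ℤ)).Nonempty →
      ((W.conductorNorm ℤ).primeFactors.filter (fun p => ¬ p ^ 2 ∣ W.conductorNorm ℤ)).gcd
        (fun p => (W.minimalDiscriminantNorm ℤ).factorization p) ≤ 5) →
    (∃ B : ℕ, ∀ (W : WeierstrassCurve ℚ) [W.IsElliptic],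
      (∀ p : ℕ, p.Prime → p ≠ 2 → ¬ p ^ 2 ∣ W.conductorNorm ℤ) → ¬ Squarefree (W.conductorNorm ℤ) →
      (∃ (a b d : ℤ) (C : WeierstrassCurve.VariableChange ℚ), IsCoprime a b ∧ a * b * (a + b) ≠ 0 ∧
        d ∣ 2 ∧ C • W = Literature.NumberTheory.EllipticCurves.freyCurve (d * a) (d * b)) →
      ((W.conductorNorm ℤ).primeFactors.filter (fun p => ¬ p ^ 2 ∣ W.conductorNorm ℤ)).Nonempty →
      ((W.conductorNorm ℤ).primeFactors.filter (fun p => ¬ p ^ 2 ∣ W.conductorNorm ℤ)).gcd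
        (fun p => (W.minimalDiscriminantNorm ℤ).factorization p) ≤ B) →
    (∀ ε : ℝ, 0 < ε → ∃ C : ℝ, ∀ (W : WeierstrassCurve ℚ) [W.IsElliptic],
      (∀ p : ℕ, p.Prime → p ≠ 2 → ¬ p ^ 2 ∣ W.conductorNorm ℤ) →
      ((W.conductorNorm ℤ).primeFactors.filter (fun p => p ≠ 2 ∧ ¬ p ^ 2 ∣ W.conductorNorm ℤ)).card ≤ 3 →
      ¬ Squarefree (W.conductorNorm ℤ) →
      (¬ ∃ (a b d : ℤ) (C : WeierstrassCurve.VariableChange ℚ), IsCoprime a b ∧ a * b * (a + b) ≠ 0 ∧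
        d ∣ 2 ∧ C • W = Literature.NumberTheory.EllipticCurves.freyCurve (d * a) (d * b)) →
      ((W.conductorNorm ℤ).primeFactors.filter (fun p => ¬ p ^ 2 ∣ W.conductorNorm ℤ)).Nonempty →
      ((((W.conductorNorm ℤ).primeFactors.filter (fun p => ¬ p ^ 2 ∣ W.conductorNorm ℤ)).gcd
        (fun p => (W.minimalDiscriminantNorm ℤ).factorization p) : ℕ) : ℝ) ≤
        C * (W.conductorNorm ℤ : ℝ) ^ ε) →
    Summit.ABC.ABC.Theses.RibetTakahashiSplit.FewPrimeValuationProduct := by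
  intro hP h₁ h₂ h₃ ε hε
  obtain ⟨B, hB⟩ := h₂
  have key := switching_valProd_le_of_bounds (fun _ => True) hP ?depth ε hε
  case depth =>
    intro ε hε
    obtain ⟨C₃, hC₃⟩ := h₃ ε hε
    refine ⟨5 + B + max C₃ 0, fun W _ hss hcard _ hS => ?_⟩
    have hNε : (1 : ℝ) ≤ (W.conductorNorm ℤ : ℝ) ^ ε :=
      Real.one_le_rpow (by exact_mod_cast W.conductorNorm_pos_holds) hε.le
    set N : ℝ := (W.conductorNorm ℤ : ℝ) with hNdef
    set G : ℕ := ((W.conductorNorm ℤ).primeFactors.filter (fun p => ¬ p ^ 2 ∣ W.conductorNorm ℤ)).gcd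
      (fun p => (W.minimalDiscriminantNorm ℤ).factorization p) with hGdef
    have hC0 : 0 ≤ max C₃ 0 := le_max_right _ _
    have hB0 : (0 : ℝ) ≤ B := Nat.cast_nonneg _
    by_cases hsq : Squarefree (W.conductorNorm ℤ)
    · have h' : (G : ℝ) ≤ 5 := by exact_mod_cast h₁ W hsq hS
      nlinarith
    by_cases hF : ∃ (a b d : ℤ) (C : WeierstrassCurve.VariableChange ℚ), IsCoprime a b ∧
        a * b * (a + b) ≠ 0 ∧ d ∣ 2 ∧ C • W = Literature.NumberTheory.EllipticCurves.freyCurve (d * a) (d * b)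
    · have h' : (G : ℝ) ≤ B := by exact_mod_cast hB W hss hsq hF hS
      nlinarith
    · have h := hC₃ W hss hcard hsq hF hS
      have h' : C₃ * N ^ ε ≤ max C₃ 0 * N ^ ε := mul_le_mul_of_nonneg_right (le_max_left _ _) (by positivity)
      nlinarith
  obtain ⟨C, hC⟩ := key
  exact ⟨C, fun W _ hss hcard => hC W hss hcard trivial⟩

end Summit.ABC.ABC.Theorems.FewPrimeValuationProduct
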